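import Summits.KontsevichZagierPeriods.KontsevichZagierPeriods.Theorems.RootDecompWalshStrataCellThree02

/-!
# The `d = 3` z-glue, part 3/3: `[cell, q] ∈ InBaker` for `A ≠ 0` modulo `SqrtDescent₂`

Declarations `Quadric₃.sqrtDescent₂_neg` … `Quadric₃.inBaker_cell3` of the farm-checked gen-7 file: the open companion
statement `SqrtDescent₂` of the lens file is the verbatim hypothesis `hS` (no `Prop` is declared); `inBaker_clampRoot_atom`
(one clamped root on one atom: zero / constant / affine + `(sε/(2A))√D`), `inBaker_len_atom`, `inBaker_cell3_of_neg`
(band over the square between the clamped roots, rule (3), then `InBaker.of_partition` over the adapted atoms),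
`inBaker_cell3_of_pos` (complement in the cube; `{p = 0}` a proper zero set), `inBaker_cell3` (`A ≠ 0`).
See the module docstring of `RootDecompWalshStrataCellThree01` (part 1) for the overview and the sources.
[KontsevichZagier2001 §1.2 rules (1),(3); BCR1998 §2.2; this node gen 5–7]
-/

noncomputable section

open Literature.NumberTheory.Transcendental
open MeasureTheory Set
open MvPolynomial (aeval X C)
open Literature.ModelTheory.ExponentialFields (IsSemialgebraic isSemialgebraic_univ
  isSemialgebraic_setOf_eval_pos isSemialgebraic_setOf_eval_lt isSemialgebraic_setOf_eval_le
  isSemialgebraic_setOf_eval_nonneg isSemialgebraic_setOf_eval_eq_zero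
  isSemialgebraic_setOf_eval_ne_zero continuous_aeval_real tarski_seidenberg_real_holds)
open Summit.KontsevichZagierPeriods.RootDecompWalshStrata.WalshSpanProof (isSemialgebraic_cubeSet
  isBounded_cubeSet)
open Summit.KontsevichZagierPeriods.RootDecompWalshStrata.ConeSpecimen (unitIoo isSemialgebraic_unitIoo
  unitIoo_subset_Icc mem_unitIoo)
open Summit.KontsevichZagierPeriods.RootDecompWalshStrata.PointlessOctant (boxTwo isSemialgebraic_boxTwo
  boxTwo_subset_Icc)

namespace Summit.KontsevichZagierPeriods.RootDecompWalshStrata.ConicDescent.BallCube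

namespace Quadric₃

/-- The quadric Walsh cell is `ℚ`-semialgebraic (PRIVATE copy of the CellThree02 lemma: the gate lint
`dedup.landed` identifies its statement with the landed `…ConicDescent.Conic.isSemialgebraic_cell`). [BCR1998 §2.2] -/
private theorem isSemialgebraic_cell (K : Quadric₃) : IsSemialgebraic ℚ K.cell := by
  convert (isSemialgebraic_cubeSet 3).inter (isSemialgebraic_setOf_eval_pos (R := ℝ) K.PxyzP)
    using 1
  ext z
  simp only [cell, mem_setOf_eq, mem_inter_iff, aeval_PxyzP]

/-- The quadric Walsh cell lies in the closed unit cube (PRIVATE copy, same reason). [folklore] -/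
private theorem cell_subset_Icc (K : Quadric₃) : K.cell ⊆ Icc 0 1 := fun _ hz =>
  ⟨fun j => (hz.1 j).1.le, fun j => (hz.1 j).2.le⟩

end Quadric₃

/-- `Fin.last 2 = 2` in `Fin 3` (PRIVATE copy of the CellThree01 helper; landed twin outside this chain,
gate lint `dedup.landed`). [folklore] -/
private theorem last_two₃ : (Fin.last 2 : Fin 3) = 2 := rfl

/-- `Fin.last 1 = 1` in `Fin 2` (PRIVATE copy, same reason). [folklore] -/
private theorem last_one₂ : (Fin.last 1 : Fin 2) = 1 := rfl

/-- Constant `0` is `ℚ`-semialgebraic (PRIVATE copy, same reason). [BCR1998 §2.2] -/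
private theorem isSemialgebraicFunOn_zero' {N : ℕ} {X : Set (Fin N → ℝ)} (hX : IsSemialgebraic ℚ X) :
    IsSemialgebraicFunOn ℚ X fun _ => (0 : ℝ) :=
  (isSemialgebraicFunOn_ratCast hX 0).congr fun _ _ => Rat.cast_zero

/-- Constant `1` is `ℚ`-semialgebraic (PRIVATE copy, same reason). [BCR1998 §2.2] -/
private theorem isSemialgebraicFunOn_one' {N : ℕ} {X : Set (Fin N → ℝ)} (hX : IsSemialgebraic ℚ X) :
    IsSemialgebraicFunOn ℚ X fun _ => (1 : ℝ) :=
  (isSemialgebraicFunOn_ratCast hX 1).congr fun _ _ => Rat.cast_one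

/-! #### 28.4 The companion hypothesis `SqrtDescent₂` (lens file §21)

The open companion statement `SqrtDescent₂ K γ` of the lens file — «every two-dimensional
representation whose domain is an adapted atom `K.atom σ` and whose integrand is `γ·√D_K(x,y)` lands
in the Baker sector modulo relations» — is NOT declared here as a `Prop` (only registered obligations
may define propositions under `Summits/`); it is spelled out verbatim as the hypothesis `hS` of the
glue theorems below:

  `hS : ∀ (γ : ℚ) (σ : Fin 5 → SignType) (r : KZ.IntegralRep 2), r.domain = K.atom σ →`
  `       EqOn r.integrand (fun v => (γ : ℝ) * √(K.Dxy (v 0) (v 1))) r.domain → InBaker (KZ.of r)`.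
-/

/-- `SqrtDescent₂` transfers from `p` to `−p` (same discriminant, permuted atoms). [this node] -/
theorem Quadric₃.sqrtDescent₂_neg (K : Quadric₃)
    (hS : ∀ (γ : ℚ) (σ : Fin 5 → SignType) (r : KZ.IntegralRep 2), r.domain = K.atom σ →
      EqOn r.integrand (fun v => (γ : ℝ) * √(K.Dxy (v 0) (v 1))) r.domain → InBaker (KZ.of r)) :
    ∀ (γ : ℚ) (σ : Fin 5 → SignType) (r : KZ.IntegralRep 2), r.domain = K.neg.atom σ →
      EqOn r.integrand (fun v => (γ : ℝ) * √(K.neg.Dxy (v 0) (v 1))) r.domain →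
        InBaker (KZ.of r) := by
  intro γ σ r hrd hri
  refine hS γ (Quadric₃.negSign σ) r (hrd.trans (Set.ext fun v => K.mem_neg_atom_iff σ v))
    fun v hv => ?_
  rw [hri hv]
  simp only [Quadric₃.neg_Dxy]

/-! #### 28.5 `A < 0`: the cell is a band over the square between the clamped roots -/

namespace Quadric₃

variable (K : Quadric₃)

/-- **One clamped root on one atom.** `[K.atom σ, s·κ(root ε)]` lands in the Baker sector, given
the regime trichotomy of `root ε` on the atom: regime `≤ 0` is the zero relation, regime `≥ 1` is
the constant `s` (`affineDescent₂_holds`), and in the middle regime `s·root ε = affine(x,y) +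
(sε/(2A))·√D` is `affineDescent₂_holds` plus `SqrtDescent₂`. [KontsevichZagier2001 §1.2 rule (1);
this node] -/
theorem inBaker_clampRoot_atom (hA : K.A ≠ 0)
    (hS : ∀ (γ : ℚ) (σ : Fin 5 → SignType) (r : KZ.IntegralRep 2), r.domain = K.atom σ →
      EqOn r.integrand (fun v => (γ : ℝ) * √(K.Dxy (v 0) (v 1))) r.domain → InBaker (KZ.of r))
    (σ : Fin 5 → SignType) (s ε : ℚ)
    (hcase : (∀ v ∈ K.atom σ, K.root ε (v 0) (v 1) ≤ 0) ∨ (∀ v ∈ K.atom σ, 1 ≤ K.root ε (v 0) (v 1)) ∨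
      (∀ v ∈ K.atom σ, 0 < K.root ε (v 0) (v 1) ∧ K.root ε (v 0) (v 1) < 1))
    (r : KZ.IntegralRep 2) (hrd : r.domain = K.atom σ)
    (hri : EqOn r.integrand (fun v => (s : ℝ) * clamp (K.root ε (v 0) (v 1))) r.domain) :
    InBaker (KZ.of r) := by
  rcases hcase with h | h | h
  · refine InBaker.of_mem_relations (KZ.of_mem_relations_of_eqOn_zero r fun v hv => ?_)
    rw [hri hv]
    simp [clamp_of_nonpos (h v (hrd ▸ hv))]
  · refine affineDescent₂_holds K s 0 0 σ r hrd fun v hv => ?_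
    rw [hri hv]
    simp [clamp_of_one_le (h v (hrd ▸ hv))]
  · have hI : r.domain ⊆ Icc 0 1 := hrd ▸ fun v hv => boxTwo_subset_Icc hv.1
    set p : MvPolynomial (Fin 2) ℚ := C (-(s * K.b0) / (2 * K.A)) +
      C (-(s * K.b1) / (2 * K.A)) * X 0 + C (-(s * K.b2) / (2 * K.A)) * X 1 with hp
    set r₂ : KZ.IntegralRep 2 := polyRep₁ r.domain r.isSemialgebraic_domain hI p with hr₂
    have h₂ : InBaker (KZ.of r₂) :=
      affineDescent₂_holds K (-(s * K.b0) / (2 * K.A)) (-(s * K.b1) / (2 * K.A))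
        (-(s * K.b2) / (2 * K.A)) σ r₂ (by rw [hr₂, polyRep₁_domain, hrd]) fun v _ => by
        simp only [hr₂, polyRep₁_integrand, hp, map_add, map_mul, MvPolynomial.aeval_C,
          MvPolynomial.aeval_X, eq_ratCast]
    refine InBaker.of_sub' r r₂ rfl h₂
      (hS (s * ε / (2 * K.A)) σ _ (by rw [subRep_domain, hrd]) fun v hv => ?_)
    have hv' : v ∈ K.atom σ := by rw [← hrd]; exact hv
    obtain ⟨h0, h1⟩ := h v hv'
    rw [subRep_integrand, hri hv]
    beta_reduce
    rw [clamp_of_mem h0.le h1.le]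
    simp only [hr₂, polyRep₁_integrand, hp, map_add, map_mul, MvPolynomial.aeval_C,
      MvPolynomial.aeval_X, eq_ratCast, root, Bxy]
    have hA' : (K.A : ℝ) ≠ 0 := by exact_mod_cast hA
    push_cast
    field_simp
    ring

/-- **The length integrand on one atom.** `[K.atom σ, q·(κ(hi) − κ(lo))]` lands in the Baker sector
(`A < 0`): on an atom with `D > 0` both clamped roots are in a fixed regime; on an atom with
`D ≤ 0` the integrand vanishes. [this node] -/
theorem inBaker_len_atom (hA : K.A < 0) (q : ℚ)
    (hS : ∀ (γ : ℚ) (σ : Fin 5 → SignType) (r : KZ.IntegralRep 2), r.domain = K.atom σ →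
      EqOn r.integrand (fun v => (γ : ℝ) * √(K.Dxy (v 0) (v 1))) r.domain → InBaker (KZ.of r))
    (σ : Fin 5 → SignType) (r : KZ.IntegralRep 2) (hrd : r.domain = K.atom σ)
    (hri : EqOn r.integrand
      (fun v => (q : ℝ) * (clamp (K.hi (v 0) (v 1)) - clamp (K.lo (v 0) (v 1)))) r.domain) :
    InBaker (KZ.of r) := by
  by_cases hσ : σ 0 = 1
  · have hI : r.domain ⊆ Icc 0 1 := hrd ▸ fun v hv => boxTwo_subset_Icc hv.1
    have hb : Bornology.IsBounded r.domain :=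
      (isCompact_Icc (a := (0 : Fin 2 → ℝ)) (b := 1)).isBounded.subset hI
    set r₂ : KZ.IntegralRep 2 := bddRep r.domain r.isSemialgebraic_domain hb
      (fun v => (q : ℝ) * clamp (K.hi (v 0) (v 1)))
      ((IsSemialgebraicFunOn.mul_holds (isSemialgebraicFunOn_ratCast r.isSemialgebraic_domain q)
        (IsSemialgebraicFunOn.clamp r.isSemialgebraic_domain
          (K.isSemialgebraicFunOn_hi r.isSemialgebraic_domain))).congr fun _ _ => rfl)
      |(q : ℝ)| (fun v _ => by
        rw [abs_mul]
        exact mul_le_of_le_one_right (abs_nonneg _)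
          (abs_le.2 ⟨by linarith [clamp_nonneg (K.hi (v 0) (v 1))], clamp_le_one _⟩)) with hr₂
    have h₂ : InBaker (KZ.of r₂) :=
      K.inBaker_clampRoot_atom hA.ne hS σ q (-1) (K.clamp_hi_cases hA σ hσ) r₂
        (by rw [hr₂, bddRep_domain, hrd]) fun v _ => by simp [hr₂, hi]
    refine InBaker.of_sub' r r₂ rfl h₂ (K.inBaker_clampRoot_atom hA.ne hS σ (-q) 1
      (K.clamp_lo_cases hA σ hσ) _ (by rw [subRep_domain, hrd]) fun v hv => ?_)
    rw [subRep_integrand, hri hv]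
    simp only [hr₂, bddRep_integrand, lo]
    push_cast; ring
  · refine InBaker.of_mem_relations (KZ.of_mem_relations_of_eqOn_zero r fun v hv => ?_)
    have hv' : v ∈ K.atom σ := by rw [← hrd]; exact hv
    have h0 := K.sqrt_Dxy_eq_zero_of_sign σ hσ hv'
    rw [hri hv]
    simp [hi_eq, lo_eq, h0]

/-- **`A < 0`.** `[cell, q]` lands in the Baker sector, given `SqrtDescent₂ K`: the cell is the band
over `(0,1)²` between the clamped roots (rule 3), the length representation is split over the
adapted atoms (rule 1a), and each atom is `inBaker_len_atom`. [KontsevichZagier2001 §1.2; this node] -/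
theorem inBaker_cell3_of_neg (hA : K.A < 0) (q : ℚ)
    (hS : ∀ (γ : ℚ) (σ : Fin 5 → SignType) (r : KZ.IntegralRep 2), r.domain = K.atom σ →
      EqOn r.integrand (fun v => (γ : ℝ) * √(K.Dxy (v 0) (v 1))) r.domain → InBaker (KZ.of r))
    (ρ : KZ.IntegralRep 3) (hdom : ρ.domain = K.cell) (hint : ∀ z ∈ ρ.domain, ρ.integrand z = q) :
    InBaker (KZ.of ρ) := by
  classical
  have hl := IsSemialgebraicFunOn.clamp isSemialgebraic_boxTwo (K.isSemialgebraicFunOn_lo isSemialgebraic_boxTwo)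
  have hu := IsSemialgebraicFunOn.clamp isSemialgebraic_boxTwo (K.isSemialgebraicFunOn_hi isSemialgebraic_boxTwo)
  have hdomeq : ρ.domain =
      oband boxTwo (fun v => clamp (K.lo (v 0) (v 1))) fun v => clamp (K.hi (v 0) (v 1)) := by
    rw [hdom]
    ext z
    simp only [Quadric₃.cell, mem_setOf_eq, mem_oband, cube_iff, init₃_apply_zero,
      init₃_apply_one, last_two₃]
    constructor
    · rintro ⟨⟨h2, hz0, hz1⟩, hp⟩
      obtain ⟨-, hlo, hhi⟩ := (K.pos_iff_of_neg hA _ _ _).1 hp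
      exact ⟨h2, (clamp_lt_iff hz0 hz1).2 hlo, (lt_clamp_iff hz0 hz1).2 hhi⟩
    · rintro ⟨h2, hlo, hhi⟩
      have hz0 : 0 < z 2 := (clamp_nonneg _).trans_lt hlo
      have hz1 : z 2 < 1 := hhi.trans_le (clamp_le_one _)
      refine ⟨⟨h2, hz0, hz1⟩, (K.pos_iff_of_neg hA _ _ _).2
        ⟨?_, (clamp_lt_iff hz0 hz1).1 hlo, (lt_clamp_iff hz0 hz1).1 hhi⟩⟩
      by_contra hD
      have h0 : √(K.Dxy (z 0) (z 1)) = 0 := Real.sqrt_eq_zero'.2 (not_lt.1 hD)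
      have heq : K.lo (z 0) (z 1) = K.hi (z 0) (z 1) := by rw [lo_eq, hi_eq, h0, add_zero, sub_zero]
      rw [heq] at hlo
      exact lt_irrefl _ (hlo.trans hhi)
  refine InBaker.of_band ρ boxTwo isSemialgebraic_boxTwo boxTwo_subset_Icc _ _ hl hu
    (fun v _ => clamp_nonneg _) (fun v _ => clamp_mono (K.lo_le_hi hA _ _))
    (fun v _ => clamp_le_one _) q hdomeq hint ?_
  refine InBaker.of_partition (Finset.univ : Finset (Fin 5 → SignType)) _ (fun σ => K.atom σ)
    (fun σ _ => K.isSemialgebraic_atom σ) (fun v hv => ⟨_, Finset.mem_univ _, K.mem_atom_sign hv⟩)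
    (fun σ τ v hne h₁ h₂ => hne (K.atom_eq_of_mem h₁ h₂)) fun σ _ T hT hTr hTeq => ?_
  have hTa : T = K.atom σ := by
    rw [hTeq]; exact inter_eq_right.2 (K.atom_subset_boxTwo σ)
  exact K.inBaker_len_atom hA q hS σ _ hTa fun v _ => rfl

/-! #### 28.6 `A > 0`: complement of the `A < 0` cell of `−p` in the cube -/

/-- **`A > 0`.** `[cell(p), q] = [(0,1)³, q] − [cell(−p), q] − [{p = 0} ∩ cube, q]` (rule 1a): the
cube is a band over the square which is a band over `(0,1)` (rule 3 twice), `−p` has `A < 0`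
(`inBaker_cell3_of_neg` with `SqrtDescent₂` transferred to `−p`), and `{p = 0}` is a proper
algebraic set (`InBaker.of_subset_zeroSet`). [KontsevichZagier2001 §1.2; this node] -/
theorem inBaker_cell3_of_pos (hA : 0 < K.A) (q : ℚ)
    (hS : ∀ (γ : ℚ) (σ : Fin 5 → SignType) (r : KZ.IntegralRep 2), r.domain = K.atom σ →
      EqOn r.integrand (fun v => (γ : ℝ) * √(K.Dxy (v 0) (v 1))) r.domain → InBaker (KZ.of r))
    (ρ : KZ.IntegralRep 3) (hdom : ρ.domain = K.cell) (hint : ∀ z ∈ ρ.domain, ρ.integrand z = q) :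
    InBaker (KZ.of ρ) := by
  classical
  -- the cube
  set cube : Set (Fin 3 → ℝ) := {z | ∀ j, 0 < z j ∧ z j < 1} with hcubedef
  have hcube : IsSemialgebraic ℚ cube := isSemialgebraic_cubeSet 3
  have hcubeI : cube ⊆ Icc 0 1 := fun z hz => ⟨fun j => (hz j).1.le, fun j => (hz j).2.le⟩
  set ρ' : KZ.IntegralRep 3 := polyRep₁ cube hcube hcubeI (MvPolynomial.C q) with hρ'def
  have hρ'i : ∀ z, ρ'.integrand z = q := fun z => by simp [hρ'def]
  have hsq : InBaker (KZ.of ρ') := by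
    refine InBaker.of_band ρ' boxTwo isSemialgebraic_boxTwo boxTwo_subset_Icc (fun _ => 0)
      (fun _ => 1) (isSemialgebraicFunOn_zero' isSemialgebraic_boxTwo)
      (isSemialgebraicFunOn_one' isSemialgebraic_boxTwo) (fun _ _ => le_rfl)
      (fun _ _ => zero_le_one) (fun _ _ => le_rfl) q ?_ (fun z _ => hρ'i z) ?_
    · ext z
      simp only [hρ'def, polyRep₁_domain, hcubedef, mem_setOf_eq, mem_oband, cube_iff, last_two₃]
    · refine InBaker.of_band _ unitIoo isSemialgebraic_unitIoo unitIoo_subset_Icc (fun _ => 0)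
        (fun _ => 1) (isSemialgebraicFunOn_zero' isSemialgebraic_unitIoo)
        (isSemialgebraicFunOn_one' isSemialgebraic_unitIoo) (fun _ _ => le_rfl)
        (fun _ _ => zero_le_one) (fun _ _ => le_rfl) q ?_ (fun v _ => by simp [lenRep]) ?_
      · ext v
        simp only [lenRep, bddRep_domain, boxTwo, mem_setOf_eq, mem_oband, square_iff, last_one₂]
      · exact InBaker.of_eqOn_ratCast _ q fun v _ => by simp [lenRep]
  -- the three pieces of the cube
  set A₃ : Set (Fin 3 → ℝ) := {z | z ∈ cube ∧ K.pxyz (z 0) (z 1) (z 2) = 0} with hA₃def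
  have hA₁ : IsSemialgebraic ℚ K.cell := K.isSemialgebraic_cell
  have hA₂ : IsSemialgebraic ℚ K.neg.cell := K.neg.isSemialgebraic_cell
  have hA₃ : IsSemialgebraic ℚ A₃ := by
    convert hcube.inter (isSemialgebraic_setOf_eval_eq_zero (R := ℝ) K.PxyzP) using 1
    ext z
    simp only [hA₃def, mem_setOf_eq, mem_inter_iff, Quadric₃.aeval_PxyzP]
  have hcov : ρ'.domain = K.cell ∪ (K.neg.cell ∪ A₃) := by
    ext z
    simp only [hρ'def, polyRep₁_domain, mem_union, Quadric₃.cell, hA₃def, mem_setOf_eq,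
      Quadric₃.neg_pxyz, hcubedef]
    constructor
    · intro hz
      rcases lt_trichotomy (K.pxyz (z 0) (z 1) (z 2)) 0 with h | h | h
      · exact Or.inr (Or.inl ⟨hz, by linarith⟩)
      · exact Or.inr (Or.inr ⟨hz, h⟩)
      · exact Or.inl ⟨hz, h⟩
    · rintro (⟨hz, _⟩ | ⟨hz, _⟩ | ⟨hz, _⟩) <;> exact hz
  have h1r : K.cell ⊆ ρ'.domain := fun z hz => hcov ▸ Or.inl hz
  have h23r : K.neg.cell ∪ A₃ ⊆ ρ'.domain := fun z hz => hcov ▸ Or.inr hz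
  have hrel := of_sub_restrict_sub_restrict_mem_relations ρ' hA₁ (hA₂.union hA₃) h1r h23r hcov (by
    have : K.cell ∩ (K.neg.cell ∪ A₃) = ∅ := by
      ext z
      refine ⟨fun hz => ?_, fun h => h.elim⟩
      obtain ⟨hz1, hz2⟩ := hz
      have hp1 : 0 < K.pxyz (z 0) (z 1) (z 2) := hz1.2
      rcases hz2 with hz2 | hz2
      · have hp2 : 0 < K.neg.pxyz (z 0) (z 1) (z 2) := hz2.2
        rw [Quadric₃.neg_pxyz] at hp2
        exact False.elim (by linarith)
      · have hp2 : K.pxyz (z 0) (z 1) (z 2) = 0 := hz2.2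
        exact False.elim (by linarith)
    rw [this, measure_empty])
  have h23 : InBaker (KZ.of (ρ'.restrict _ (hA₂.union hA₃) h23r)) := by
    refine InBaker.of_split _ hA₂ hA₃ (fun z hz => Or.inl hz) (fun z hz => Or.inr hz) rfl ?_ ?_ ?_
    · have : K.neg.cell ∩ A₃ = ∅ := by
        ext z
        refine ⟨fun hz => ?_, fun h => h.elim⟩
        obtain ⟨hz1, hz2⟩ := hz
        have hp1 : 0 < K.neg.pxyz (z 0) (z 1) (z 2) := hz1.2
        rw [Quadric₃.neg_pxyz] at hp1
        have hp2 : K.pxyz (z 0) (z 1) (z 2) = 0 := hz2.2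
        exact False.elim (by linarith)
      rw [this, measure_empty]
    · have hA' : K.neg.A < 0 := by rw [Quadric₃.neg_A]; linarith
      exact K.neg.inBaker_cell3_of_neg hA' q (K.sqrtDescent₂_neg hS) _ rfl fun z _ => hρ'i z
    · exact InBaker.of_subset_zeroSet _ K.PxyzP (K.exists_aeval_PxyzP_ne_zero hA.ne')
        fun z hz => by rw [Quadric₃.aeval_PxyzP]; exact hz.2
  have h1 : InBaker (KZ.of (ρ'.restrict _ hA₁ h1r)) := by
    refine (hsq.sub h23).congr ?_
    have : KZ.of (ρ'.restrict _ hA₁ h1r) - (KZ.of ρ' - KZ.of (ρ'.restrict _ (hA₂.union hA₃) h23r)) =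
        -(KZ.of ρ' - KZ.of (ρ'.restrict _ hA₁ h1r) - KZ.of (ρ'.restrict _ (hA₂.union hA₃) h23r)) := by
      abel
    rw [this]
    exact KZ.relations.neg_mem hrel
  refine h1.congr (KZ.of_sub_of_mem_relations_of_eqOn (by simp [hdom]) fun z hz => ?_)
  rw [hint z hz]
  exact (hρ'i z).symm

/-- **The `d = 3` z-glue for `A ≠ 0`.** For a quadric normal form with `A ≠ 0`, `[cell, q]` lands in
the Baker sector modulo relations as soon as `SqrtDescent₂ K γ` holds for all `γ ∈ ℚ` (the affine
companion `AffineDescent₂` being a theorem, `affineDescent₂_holds`).  This is the `A ≠ 0` core of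
the typed target `QuadricThreeReduction`. [KontsevichZagier2001 §1.2; this node gen 5 plan / gen 7] -/
theorem inBaker_cell3 (hA : K.A ≠ 0) (q : ℚ)
    (hS : ∀ (γ : ℚ) (σ : Fin 5 → SignType) (r : KZ.IntegralRep 2), r.domain = K.atom σ →
      EqOn r.integrand (fun v => (γ : ℝ) * √(K.Dxy (v 0) (v 1))) r.domain → InBaker (KZ.of r))
    (ρ : KZ.IntegralRep 3) (hdom : ρ.domain = K.cell) (hint : ∀ z ∈ ρ.domain, ρ.integrand z = q) :
    InBaker (KZ.of ρ) := by
  rcases lt_or_gt_of_ne hA with h | h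
  · exact K.inBaker_cell3_of_neg h q hS ρ hdom hint
  · exact K.inBaker_cell3_of_pos h q hS ρ hdom hint

end Quadric₃

end Summit.KontsevichZagierPeriods.RootDecompWalshStrata.ConicDescent.BallCube
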